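import Summits.BirchSwinnertonDyer.BirchSwinnertonDyer.Theorems.KatoDescentPotSupersingularIntegralH1RankZeroDichotomy
import Summits.BirchSwinnertonDyer.BirchSwinnertonDyer.Theorems.CongruentShaFreeCutIntegralH1RankLeOne
import Literature.NumberTheory.EllipticCurves.PAdicBSDKatoFiniteProofs
import Literature.NumberTheory.EllipticCurves.Kato2004.IwasawaH2DescentFiniteSelmer
import Literature.NumberTheory.EllipticCurves.Kato2004.MemberHullInputs
import Literature.NumberTheory.EllipticCurves.Kato2004.IntegralH1FiniteProofs
import Literature.NumberTheory.EllipticCurves.Kato2004.IwasawaH1ProjZeroKernelProofs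
import Literature.NumberTheory.EllipticCurves.Kato2004.IwasawaH1LambdaTorsionFreeProofs

set_option linter.dupNamespace false
set_option autoImplicit false

/-! # Crux M `ReducibleKatoMember` (stmt-BirchSwinnertonDyer-19196, routes `KatoDescentPotSupersingular` (K9) /
`KatoDescentTamePotSupersingular` (K8-t′)) — (R0) «`W(ℚ)` finite ∧ `Ш(W)[p^∞]` finite ⇒
`rank_{ℤ_p} H¹(ℤ[1/p], T_pW) ≤ 1» PROVED (Kato Thm. 14.5 (1) / 14.13 on the pin, Euler-system-free), and the
named fact `Kato2004.finite_descentCokernel_of_finite_selmer` REDUCED to `Kato2004.thm12_4` (part 3 of 3)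

Cell `bsd-potss`, prover seat `bsd-potss-rkm` g9.  Supports, does not close, stmt-BirchSwinnertonDyer-19196:
the clauses `finite_coinvariants_H2` (Thm. 14.5 (1) with (14.14.2)) and `index_ne_zero` (Thm. 14.5 (2)) of the
held input `Kato2004.exists_memberHullInputs` (item 19659) are statements about a rank-`0` curve at the bottom
layer; this file proves the arithmetic input they rest on, for EVERY elliptic curve over `ℚ` with finite
Mordell–Weil group and finite `Ш[p^∞]` and EVERY prime `p` (no reduction-type, image or parity hypothesis),
and derives the finiteness of Kato's descent cokernel `H¹(ℤ[1/p], T_pW) / proj₀(𝐇¹_Γ/T)` on every pin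
whose `𝐇¹_Γ` is non-zero.  Theorems only (no definition, no named fact, no `sorry`); route-free.

## Contents

* §4b **`exists_smul_add_smul_eq_zero_of_mem_integralH1`** / **`rank_integralH1_top_le_one`** /
  **`rank_integralH1_layerZero_le_one`**: (R0).  The global skeleton is cell `bsd-cn100`'s (R1) proof
  (`CongruentShaFreeCutIntegralH1RankLeOne.exists_smul_add_smul_eq_zero_of_mem_integralH1`, p508547) with
  its rank-one step (F1) replaced by the levelwise dichotomy of part 2
  (`exists_uniform_levelwise_dichotomy`, from the LOCAL dichotomy of part 1 — local Tate duality for `E` at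
  `p`): the admissible `p`-adic multipliers form closed decreasing subsets of the compact `ℤ_p`, and a class
  of `H¹(⊤, T_pW)` with all reductions zero is zero (Rubin App. B Prop. B.2.3, tree
  `Kato2004.eq_zero_of_forall_reduceH1Pk_eq_zero`) — steps (F2)–(F5) verbatim.
* §5 **`finite_descentCokernel_of_finite_point_of_finite_sha`**: on a pin `I : IwasawaH1Data W p κ γ`
  (`κ` cyclotomic, `γ` a topological generator) with `I.H ≠ 0`, `W(ℚ)` finite and `Ш[p^∞]` finite ⟹
  `IwasawaH1Data.descentCokernel I` finite — cn100's pin-level reduction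
  `Kato2004.IwasawaH1Data.finite_descentCokernel_of_rank_le_one` with ALL its module-theoretic inputs now
  theorems of the tree ((α) = Kato (14.14.1) injectivity `Kato2004.TwistTate.mem_TSubmodule_of_proj_zero_eq_zero`
  (rkm g8, p510488), (12.2.1) `IwasawaH1Data.module_finite_of_isCyclotomic`, Thm. 12.4 (2) torsion-freeness
  `IwasawaH1Data.isTorsionFree` (rkm g7, p491527)) and (R0); on a descent package
  (`IwasawaH2Data`, in particular on the (A, ι, π, H2)-part of `MemberHullInputs`) this is
  `Finite (coinvariants p H2)` (**`IwasawaH2Data.finite_coinvariants_H2_of_finite_point_of_finite_sha`**), i.e. the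
  package clause `finite_coinvariants_H2`; and **`finite_descentCokernel_of_finite_selmer_of_thm12_4`**: the
  named fact `Kato2004.finite_descentCokernel_of_finite_selmer` (cell `bsd-2adic`, binder `h31` of the rank-`0`
  Kato–zeta roads of route `TwoAdicConverse`) follows from `Kato2004.thm12_4` ALONE (only its `Λ`-rank-one
  clause is used, to make `𝐇¹_Γ ≠ 0`).
* §6 On the package `Kato2004.MemberHullInputs` of crux M itself: **`MemberHullInputs.nontrivial_H`** (the zeta
  fields `j_y`, `z_ne_zero`, `lam_constantCoeff_ne_zero`, `torsionFree_F` force `𝐇¹_Γ ≠ 0`),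
  **`MemberHullInputs.finite_coinvariants_H2_of_otherFields`** (the clause `finite_coinvariants_H2` re-derived
  WITHOUT using it, for `W(ℚ)` and `Ш[p^∞]` finite — evidence that a re-typed held input 19659 can drop it) and
  **`MemberHullInputs.finite_torsion_A`** (the clause `finite_torsion_A` of the sharp count package
  `Kato2004.MemberCountInputs`, item 19707, holds on every package: `A ≅ H¹(ℤ[1/p],T_pW)` is finitely generated
  over `ℤ_p`, tree `Kato2004.module_finite_integralH1_layerZero`).

HONEST FRAMING: Galois-cohomology bookkeeping over tree theorems; no named fact is introduced or discharged
outright (the 2adic fact is reduced to `thm12_4`, whose rank-one clause is Kato's Euler-system theorem); nothing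
about the zeta side of crux M (explicit reciprocity, `𝐇²` torsion, divisibility), the leaf or BSD is proved.
PARTITION (D-0054): types-the-object-of two clauses of held input 19659 of crux M (B5 O6 wild 3 × X3 reducible
rows + B4 (t′) X3 rows); closes NONE.

References: [Kato2004Asterisque] Thm. 14.5 (1) (p. 236), (14.9.3) (p. 240), 14.13, (14.14.1) (p. 243), Thm. 12.4
(p. 221); [MilneADT2006] I Cor. 2.3, 3.4, Lemma 6.15; [Rubin2000] App. B Prop. B.2.3; [BurungaleTian2026] (3.1). -/

noncomputable section

open scoped Classical NumberField

namespace Summit.BirchSwinnertonDyer.BirchSwinnertonDyer.Theorems.IntegralH1RankZero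

open CategoryTheory Field IsDedekindDomain NumberField Function
open WeierstrassCurve (geomPoints geomTorsion galH1Torsion selmerLocalKer selmerGroup torsionPoints
  torsionGaloisModule kummerMapTorsion kummerMapTorsion_mem_selmerLocalKer)
open Literature.NumberTheory.GaloisRepresentations Literature.NumberTheory.GaloisCohomology
open Literature.NumberTheory.GaloisRepresentations.DiscreteGaloisModule (mu MuCarrier SelmerStructure)
open Literature.NumberTheory.EllipticCurves Literature.NumberTheory.EllipticCurves.Kato2004
open Literature.NumberTheory.EllipticCurves.Kato2004.EulerSystemValues
open Literature.NumberTheory.EllipticCurves.IwasawaAlgebra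
open Summit.BirchSwinnertonDyer.Rank1Residual
open Summit.BirchSwinnertonDyer.BirchSwinnertonDyer.Theorems.CongruentShaFreeCutIntegralH1RankLeOne
open Summit.BirchSwinnertonDyer.BirchSwinnertonDyer.Theorems.CongruentShaFreeCutSelmerRankOneLevelwise
open scoped ContRepresentation

/-! ## §4 (R0): `rank_{ℤ_p} H¹(ℤ[1/p], T_pW) ≤ 1` when `W(ℚ)` and `Ш[p^∞]` are finite -/

section RankZero

variable (W : WeierstrassCurve ℚ) [W.IsElliptic] (p : ℕ) [Fact p.Prime]
  [ContinuousSMul ℤ_[p] (W.tateModule p)]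

/-- **(R0) for `H¹(Γ_ℚ, T_pW)`: any two integral classes are `ℤ_p`-linearly dependent** when `W(ℚ)` and
`Ш(W)[p^∞]` are finite.  The levelwise dichotomy (`exists_uniform_levelwise_dichotomy`) gives, at every level
`p^{k+1}`, a digit `ℓ` with `red(M•y − ℓ•M•x) = 0` or `red(M•x − ℓ•M•y) = 0`; the sets of admissible `p`-adic
multipliers are closed and decrease with `k`, so compactness of `ℤ_p` yields ONE `μ` with all reductions of
`M•y − μ•M•x` (or of `M•x − μ•M•y`) zero, i.e. the class itself is zero (Rubin App. B Prop. B.2.3, tree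
`eq_zero_of_forall_reduceH1Pk_eq_zero`) — steps (F2)–(F5) of cn100's rank-one proof, verbatim.
[cite: Rubin2000, App. B Prop. B.2.3] [cite: Kato2004Asterisque, 14.13 and §14.14 (14.14.1) (p. 243)] -/
theorem exists_smul_add_smul_eq_zero_of_mem_integralH1 [Finite W.toAffine.Point]
    [Finite (AddCommGroup.primaryComponent W.sha p)]
    (x y : H1 (tateRep W p) ⊤) (hx : x ∈ integralH1 (tateRep W p) p ⊤)
    (hy : y ∈ integralH1 (tateRep W p) p ⊤) :
    ∃ a b : ℤ_[p], (a ≠ 0 ∨ b ≠ 0) ∧ a • x + b • y = 0 := by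
  have hp : p.Prime := Fact.out
  obtain ⟨M, hM0, hM⟩ := exists_uniform_levelwise_dichotomy W p
  have hMp : (M : ℤ_[p]) ≠ 0 := Nat.cast_ne_zero.mpr hM0
  set MX : H1 (tateRep W p) ⊤ := M • x with hMX
  set MY : H1 (tateRep W p) ⊤ := M • y with hMY
  set Λ₁ : ℕ → Set ℤ_[p] := fun k => {μ | reduceH1Pk W p (k + 1) ⊤ (MY - μ • MX) = 0} with hΛ₁
  set Λ₂ : ℕ → Set ℤ_[p] := fun k => {μ | reduceH1Pk W p (k + 1) ⊤ (MX - μ • MY) = 0} with hΛ₂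
  -- (F1) dichotomy at each level (integer multipliers are `p`-adic integers)
  have hF1 : ∀ k, (Λ₁ k).Nonempty ∨ (Λ₂ k).Nonempty := by
    intro k
    obtain ⟨ℓ, h | h⟩ := hM x y hx hy k
    · refine Or.inl ⟨(ℓ : ℤ_[p]), ?_⟩
      show reduceH1Pk W p (k + 1) ⊤ (MY - (ℓ : ℤ_[p]) • MX) = 0
      rw [Int.cast_smul_eq_zsmul]
      exact h
    · refine Or.inr ⟨(ℓ : ℤ_[p]), ?_⟩
      show reduceH1Pk W p (k + 1) ⊤ (MX - (ℓ : ℤ_[p]) • MY) = 0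
      rw [Int.cast_smul_eq_zsmul]
      exact h
  -- (F2) the sets decrease
  have hF2₁ : ∀ k, Λ₁ (k + 1) ⊆ Λ₁ k := fun k μ hμ => reduceH1Pk_eq_zero_of_succ W p _ _ hμ
  have hF2₂ : ∀ k, Λ₂ (k + 1) ⊆ Λ₂ k := fun k μ hμ => reduceH1Pk_eq_zero_of_succ W p _ _ hμ
  -- (F3) the sets are closed: membership depends only on `μ mod p^{k+1}`
  have hclosed : ∀ (k : ℕ) (u w : H1 (tateRep W p) ⊤),
      IsClosed {μ : ℤ_[p] | reduceH1Pk W p (k + 1) ⊤ (w - μ • u) = 0} := by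
    intro k u w
    refine isClosed_of_closure_subset fun μ hμ => ?_
    have hε : (0 : ℝ) < (p : ℝ) ^ (-(k + 1 : ℕ) : ℤ) := zpow_pos (by exact_mod_cast hp.pos) _
    obtain ⟨μ₀, hμ₀, hdist⟩ := Metric.mem_closure_iff.mp hμ _ hε
    have hmem : μ - μ₀ ∈ Ideal.span {(p : ℤ_[p]) ^ (k + 1)} := by
      rw [← PadicInt.norm_le_pow_iff_mem_span_pow]
      rw [dist_eq_norm] at hdist
      exact hdist.le
    obtain ⟨ν, hν⟩ := Ideal.mem_span_singleton'.mp hmem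
    have hμeq : μ = μ₀ + (p : ℤ_[p]) ^ (k + 1) * ν := by rw [mul_comm, hν]; ring
    show reduceH1Pk W p (k + 1) ⊤ (w - μ • u) = 0
    have h0 : reduceH1Pk W p (k + 1) ⊤ (w - μ₀ • u) = 0 := hμ₀
    rw [hμeq, add_smul, ← sub_sub, map_sub, h0, mul_smul, reduceH1Pk_pow_smul, sub_zero]
  -- (F4) one of the two families is non-empty at every level
  have hanti₁ : Antitone Λ₁ := antitone_nat_of_succ_le hF2₁
  have hanti₂ : Antitone Λ₂ := antitone_nat_of_succ_le hF2₂
  have hF4 : (∀ k, (Λ₁ k).Nonempty) ∨ (∀ k, (Λ₂ k).Nonempty) := by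
    by_cases h : ∀ k, (Λ₁ k).Nonempty
    · exact Or.inl h
    · obtain ⟨k₀, hk₀⟩ := not_forall.mp h
      refine Or.inr fun k => ?_
      have hK : ¬ (Λ₁ (max k k₀)).Nonempty := fun hne =>
        hk₀ (hne.mono (hanti₁ (le_max_right k k₀)))
      rcases hF1 (max k k₀) with h1 | h2
      · exact absurd h1 hK
      · exact h2.mono (hanti₂ (le_max_left k k₀))
  -- (F5) compactness of `ℤ_p` and Rubin's injectivity into the product of the levels
  have conclude : ∀ (u w : H1 (tateRep W p) ⊤) (Λ : ℕ → Set ℤ_[p]),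
      (∀ k, Λ k = {μ : ℤ_[p] | reduceH1Pk W p (k + 1) ⊤ (w - μ • u) = 0}) →
      (∀ k, Λ (k + 1) ⊆ Λ k) → (∀ k, (Λ k).Nonempty) → ∃ μ : ℤ_[p], w - μ • u = 0 := by
    intro u w Λ hΛ hdec hne
    have hcl : ∀ k, IsClosed (Λ k) := fun k => by rw [hΛ k]; exact hclosed k u w
    obtain ⟨μ, hμ⟩ := IsCompact.nonempty_iInter_of_sequence_nonempty_isCompact_isClosed Λ hdec hne
      (hcl 0).isCompact hcl
    refine ⟨μ, eq_zero_of_forall_reduceH1Pk_eq_zero W p ⊤ _ fun j => ?_⟩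
    have hall : ∀ k, reduceH1Pk W p (k + 1) ⊤ (w - μ • u) = 0 := fun k => by
      have h := Set.mem_iInter.mp hμ k
      rw [hΛ k] at h
      exact h
    cases j with
    | zero => exact reduceH1Pk_eq_zero_of_succ W p 0 _ (hall 0)
    | succ j => exact hall j
  rcases hF4 with h | h
  · obtain ⟨μ, hμ⟩ := conclude MX MY Λ₁ (fun k => rfl) hF2₁ h
    refine ⟨-(μ * (M : ℤ_[p])), (M : ℤ_[p]), Or.inr hMp, ?_⟩
    have e : (M : ℤ_[p]) • y = μ • ((M : ℤ_[p]) • x) := by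
      rw [Nat.cast_smul_eq_nsmul, Nat.cast_smul_eq_nsmul]
      exact sub_eq_zero.mp hμ
    rw [neg_smul, mul_smul, e, neg_add_cancel]
  · obtain ⟨μ, hμ⟩ := conclude MY MX Λ₂ (fun k => rfl) hF2₂ h
    refine ⟨(M : ℤ_[p]), -(μ * (M : ℤ_[p])), Or.inl hMp, ?_⟩
    have e : (M : ℤ_[p]) • x = μ • ((M : ℤ_[p]) • y) := by
      rw [Nat.cast_smul_eq_nsmul, Nat.cast_smul_eq_nsmul]
      exact sub_eq_zero.mp hμ
    rw [neg_smul, mul_smul, e, add_neg_cancel]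

/-- **(R0) at the top subgroup: `rank_{ℤ_p} H¹(ℤ[1/p], T_pW) ≤ 1`** (the tree's `Kato2004.integralH1 … ⊤`)
when `W(ℚ)` and `Ш(W)[p^∞]` are finite: every pair of integral classes is linearly dependent.  Kato proves the
rank is exactly `1` when `L(E,1) ≠ 0` (Thm. 14.5 (1), via 14.2 and (14.9.3)); here the input is the finiteness
of `W(ℚ)` and `Ш[p^∞]` directly, for every `p` and every reduction type.
[cite: Kato2004Asterisque, Thm. 14.5 (1) (p. 236) and 14.13 (p. 243)] -/
theorem rank_integralH1_top_le_one [Finite W.toAffine.Point]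
    [Finite (AddCommGroup.primaryComponent W.sha p)] :
    Module.rank ℤ_[p] (integralH1 (tateRep W p) p ⊤) ≤ 1 := by
  classical
  refine rank_le fun s hs => ?_
  by_contra hlt
  push Not at hlt
  obtain ⟨x, hx, y, hy, hxy⟩ := Finset.one_lt_card.mp hlt
  obtain ⟨a, b, hab, hrel⟩ :=
    exists_smul_add_smul_eq_zero_of_mem_integralH1 W p (x : H1 (tateRep W p) ⊤) (y : H1 (tateRep W p) ⊤)
      x.2 y.2
  let f : Fin 2 → ↥s := ![⟨x, hx⟩, ⟨y, hy⟩]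
  have hf : Function.Injective f := by
    intro i j hij
    fin_cases i <;> fin_cases j
    · rfl
    · exact absurd (congrArg (fun z : ↥s => (z : integralH1 (tateRep W p) p ⊤)) hij) hxy
    · exact absurd (congrArg (fun z : ↥s => (z : integralH1 (tateRep W p) p ⊤)) hij).symm hxy
    · rfl
  have hli := hs.comp f hf
  have hsum : ∑ i : Fin 2, (![a, b] i) • ((fun i : ↥s => (i : integralH1 (tateRep W p) p ⊤)) ∘ f) i = 0 := by
    rw [Fin.sum_univ_two]
    apply Subtype.ext
    change ((a • x + b • y : integralH1 (tateRep W p) p ⊤) : H1 (tateRep W p) ⊤) = 0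
    push_cast
    exact hrel
  have h0 := Fintype.linearIndependent_iff.mp hli ![a, b] hsum
  rcases hab with ha | hb
  · exact ha (by simpa using h0 0)
  · exact hb (by simpa using h0 1)

/-- **(R0) at the bottom layer of a `ℤ_p`-extension** (the shape consumed by
`Kato2004.IwasawaH1Data.finite_descentCokernel_of_rank_le_one`): `rank_{ℤ_p} H¹(ℤ[1/p], T_pW) ≤ 1` for
`integralH1 … (κ.layerSubgroup 0)`, by the injective `ℤ_p`-linear map `layerZeroToTop` into the `⊤` version.
[cite: Kato2004Asterisque, Thm. 14.5 (1) (p. 236) and 14.13 (p. 243)] -/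
theorem rank_integralH1_layerZero_le_one (κ : ZpExtension ℚ p) [Finite W.toAffine.Point]
    [Finite (AddCommGroup.primaryComponent W.sha p)] :
    Module.rank ℤ_[p] (integralH1 (tateRep W p) p (κ.layerSubgroup 0)) ≤ 1 := by
  let f : integralH1 (tateRep W p) p (κ.layerSubgroup 0) →ₗ[ℤ_[p]] integralH1 (tateRep W p) p ⊤ :=
    { toFun := fun x ↦ ⟨layerZeroToTop W p κ (x : H1 (tateRep W p) (κ.layerSubgroup 0)),
        layerZeroToTop_mem_integralH1 W p κ x.2⟩
      map_add' := fun x y ↦ Subtype.ext (by simp only [Submodule.coe_add, map_add])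
      map_smul' := fun a x ↦ Subtype.ext (by
        simp only [Submodule.coe_smul, RingHom.id_apply]
        exact layerZeroToTop_smul W p κ a x) }
  have hf : Function.Injective f := fun x y hxy ↦ by
    have h : layerZeroToTop W p κ (x : H1 (tateRep W p) (κ.layerSubgroup 0)) =
        layerZeroToTop W p κ (y : H1 (tateRep W p) (κ.layerSubgroup 0)) := congrArg Subtype.val hxy
    refine Subtype.ext ?_
    rw [← sub_eq_zero] at h ⊢
    rw [← map_sub] at h
    exact eq_zero_of_layerZeroToTop_eq_zero W p κ _ h
  exact (LinearMap.rank_le_of_injective f hf).trans (rank_integralH1_top_le_one W p)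

/-- (R0) under the finite-`Sel_{p^∞}` hypothesis (`Sel_{p^∞}(W/ℚ)` finite `⟺` `W(ℚ)` and `Ш[p^∞]` finite, tree
`WeierstrassCurve.finite_selmerGroupPInfty_iff`). [cite: Kato2004Asterisque, Thm. 14.5 (1) (p. 236) and 14.13 (p. 243)] -/
theorem rank_integralH1_layerZero_le_one_of_finite_selmerGroupPInfty (κ : ZpExtension ℚ p)
    [Finite (W.selmerGroupPInfty p)] :
    Module.rank ℤ_[p] (integralH1 (tateRep W p) p (κ.layerSubgroup 0)) ≤ 1 := by
  obtain ⟨h₁, h₂⟩ := (W.finite_selmerGroupPInfty_iff p).mp ‹_›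
  haveI := h₁
  haveI := h₂
  exact rank_integralH1_layerZero_le_one W p κ

end RankZero

/-! ## §5 Kato's descent cokernel on the pin in rank zero; the 2adic fact from `thm12_4` -/

section Pin

variable {W : WeierstrassCurve ℚ} [W.IsElliptic] {p : ℕ} [Fact p.Prime]
  [ContinuousSMul ℤ_[p] (W.tateModule p)] {κ : ZpExtension ℚ p} {γ : absoluteGaloisGroup ℚ}

/-- **Kato's descent cokernel `H¹(ℤ[1/p], T_pW) / proj₀(𝐇¹_Γ/T)` is FINITE on every non-zero pin, for `W(ℚ)`
and `Ш[p^∞]` finite** (`κ` cyclotomic, `γ` a topological generator).  cn100's pin-level reduction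
`IwasawaH1Data.finite_descentCokernel_of_rank_le_one` with every input a tree theorem: (α) Kato (14.14.1)
injectivity (`TwistTate.mem_TSubmodule_of_proj_zero_eq_zero`, rkm g8), (12.2.1)
(`IwasawaH1Data.module_finite_of_isCyclotomic`), Thm. 12.4 (2) torsion-freeness (`IwasawaH1Data.isTorsionFree`,
rkm g7) and (R0) (`rank_integralH1_layerZero_le_one`).  The only hypothesis left is `I.H ≠ 0` (true for Kato's
`𝐇¹`, of `Λ`-rank one; on the package of crux M it holds because the zeta class `𝐲` is non-zero).
[cite: Kato2004Asterisque, §14.14 (14.14.1) (p. 243), 14.13 (p. 243), Thm. 12.4 (2) (p. 221)] -/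
theorem finite_descentCokernel_of_finite_point_of_finite_sha (hκ : κ.IsCyclotomic) (hγ : κ.IsTopGenerator γ)
    (I : IwasawaH1Data W p κ γ) [Nontrivial I.H] [Finite W.toAffine.Point]
    [Finite (AddCommGroup.primaryComponent W.sha p)] : Finite I.descentCokernel := by
  haveI : Module.Finite (IwasawaAlgebra p) I.H := IwasawaH1Data.module_finite_of_isCyclotomic hκ hγ I
  haveI : Module.IsTorsionFree (IwasawaAlgebra p) I.H := IwasawaH1Data.isTorsionFree hγ I
  exact I.finite_descentCokernel_of_rank_le_one
    (fun x hx => TwistTate.mem_TSubmodule_of_proj_zero_eq_zero W p κ hκ hγ I x hx)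
    (rank_integralH1_layerZero_le_one W p κ)

/-- **On a descent package: `𝐇²_Γ/T·𝐇²_Γ` is finite in rank zero** — for every `J : IwasawaH2Data W p κ γ I`
on a non-zero pin with `W(ℚ)`, `Ш[p^∞]` finite, `Finite (coinvariants p J.H2)`; by (14.14.1) on the package
(`IwasawaH2Data.finite_descentCokernel_iff_finite_coinvariants_H2`).  This is the CONTENT of the clause
`finite_coinvariants_H2` (Kato Thm. 14.5 (1) with (14.14.2): `H²(ℤ[1/p],T) = 𝐇²/T𝐇²` finite) of the package
`Kato2004.MemberHullInputs` of crux M, whose (A, ι, π, H2)-fields are those of an `IwasawaH2Data`.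
[cite: Kato2004Asterisque, Thm. 14.5 (1) (p. 236), §14.14 (14.14.1)–(14.14.2) (p. 243)] -/
theorem IwasawaH2Data.finite_coinvariants_H2_of_finite_point_of_finite_sha (hκ : κ.IsCyclotomic)
    (hγ : κ.IsTopGenerator γ) {I : IwasawaH1Data W p κ γ} [Nontrivial I.H] (J : IwasawaH2Data W p κ γ I)
    [Finite W.toAffine.Point] [Finite (AddCommGroup.primaryComponent W.sha p)] :
    Finite (coinvariants p J.H2) :=
  J.finite_descentCokernel_iff_finite_coinvariants_H2.mp
    (finite_descentCokernel_of_finite_point_of_finite_sha hκ hγ I)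

/-- **The named fact `Kato2004.finite_descentCokernel_of_finite_selmer` (cell `bsd-2adic`, binder `h31` of the
rank-`0` Kato–zeta roads) from `Kato2004.thm12_4` ALONE** — (α), (12.2.1), torsion-freeness and (R0) being
theorems, only the `Λ`-rank-one clause of Thm. 12.4 (2) is used, to get `𝐇¹_Γ ≠ 0`.
[cite: Kato2004Asterisque, Thm. 12.4 (2) (p. 221), §14.14 (14.14.1)–(14.14.2) and 14.13 (p. 243)] -/
theorem finite_descentCokernel_of_finite_selmer_of_thm12_4 (h12 : thm12_4) :
    finite_descentCokernel_of_finite_selmer := by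
  intro W _ p _ _ κ γ hκ hγ I hfin
  haveI := hfin
  obtain ⟨h₁, h₂⟩ := (W.finite_selmerGroupPInfty_iff p).mp hfin
  haveI := h₁
  haveI := h₂
  obtain ⟨-, ⟨-, hrk⟩, -⟩ := h12 W p κ γ hκ hγ I
  haveI : Nontrivial I.H := by
    by_contra hnt
    rw [not_nontrivial_iff_subsingleton] at hnt
    have h0 : Module.rank (IwasawaAlgebra p) I.H = 0 := rank_subsingleton' _ _
    rw [hrk] at h0
    exact one_ne_zero h0
  exact finite_descentCokernel_of_finite_point_of_finite_sha hκ hγ I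

end Pin

/-! ## §6 On the package of crux M (`Kato2004.MemberHullInputs`): the clause `finite_coinvariants_H2` is
derivable from the other fields -/

section Member

variable {W : WeierstrassCurve ℚ} [W.IsElliptic] {p : ℕ} [Fact p.Prime]
  [ContinuousSMul ℤ_[p] (W.tateModule p)] {κ : ZpExtension ℚ p} {γ : absoluteGaloisGroup ℚ}
  {I : IwasawaH1Data W p κ γ} {y : I.H}

/-- **On the package of crux M the pin is non-zero**: `j y = λ • z` with `z ≠ 0`, `λ(0) ≠ 0` in the
torsion-free hull `F` forces `y ≠ 0`, so `𝐇¹_Γ = I.H` is non-trivial — the only hypothesis of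
`finite_descentCokernel_of_finite_point_of_finite_sha` beyond the finiteness of `W(ℚ)` and `Ш[p^∞]`.
Uses only the zeta-side fields `j_y`, `z_ne_zero`, `lam_constantCoeff_ne_zero`, `torsionFree_F`.
[cite: Kato2004Asterisque, Thm. 12.5 (1)(2) (pp. 221–222) and Lemma 13.10 (1) (p. 230)] -/
theorem MemberHullInputs.nontrivial_H (D : MemberHullInputs W p κ γ I y) : Nontrivial I.H := by
  haveI := D.torsionFree_F
  have hlam : D.lam ≠ 0 := fun h => D.lam_constantCoeff_ne_zero (by rw [h, map_zero])
  have hy : y ≠ 0 := by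
    intro h
    apply smul_ne_zero hlam D.z_ne_zero
    rw [← D.j_y]
    subst h
    exact map_zero D.j
  exact nontrivial_of_ne y 0 hy

/-- **The clause `finite_coinvariants_H2` of `Kato2004.MemberHullInputs` (Kato Thm. 14.5 (1) with (14.14.2):
`H²(ℤ[1/p],T) = 𝐇²/T𝐇²` finite) is DERIVABLE from the other fields** once `W(ℚ)` and `Ш(W)[p^∞]` are finite
(`κ` cyclotomic, `γ` a topological generator): the proof below reads the `(H2, A, toH1, ι, π)`-fields of the
package as an `IwasawaH2Data` and applies `IwasawaH2Data.finite_coinvariants_H2_of_finite_point_of_finite_sha`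
(with `MemberHullInputs.nontrivial_H`); it does NOT use the field `D.finite_coinvariants_H2`.  The statement is
of course implied by that field — the content is the proof (evidence for re-typing the held input
`Kato2004.exists_memberHullInputs` of item stmt-BirchSwinnertonDyer-19659 without this clause).
[cite: Kato2004Asterisque, Thm. 14.5 (1) (p. 236), §14.14 (14.14.1)–(14.14.2) (p. 243)] -/
theorem MemberHullInputs.finite_coinvariants_H2_of_otherFields (hκ : κ.IsCyclotomic)
    (hγ : κ.IsTopGenerator γ) (D : MemberHullInputs W p κ γ I y) [Finite W.toAffine.Point]
    [Finite (AddCommGroup.primaryComponent W.sha p)] : Finite (coinvariants p D.H2) := by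
  haveI := MemberHullInputs.nontrivial_H D
  let J : IwasawaH2Data W p κ γ I :=
    { H2 := D.H2
      finite_H2 := D.finite_H2
      isTorsion_H2 := D.isTorsion_H2
      A := D.A
      toH1 := D.toH1
      toH1_injective := D.toH1_injective
      mem_range_toH1_iff := D.mem_range_toH1_iff
      toH1_smul := D.toH1_smul
      ι := D.ι
      π := D.π
      ι_injective := D.ι_injective
      π_surjective := D.π_surjective
      exact_ι_π := D.exact_ι_π
      toH1_ι := D.toH1_ι }
  exact IwasawaH2Data.finite_coinvariants_H2_of_finite_point_of_finite_sha hκ hγ J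

/-- **The clause `finite_torsion_A` of the sharp count package `Kato2004.MemberCountInputs` (Kato Thm. 14.5 (1):
the torsion of `H¹(ℤ[1/p],T)` is finite) holds on EVERY package** — `A ≅ H¹(ℤ[1/p], T_pW)` (the pin `toH1`) is
a finitely generated `ℤ_p`-module (tree `Kato2004.module_finite_integralH1_layerZero`, rkm/cn100), whose torsion
is finite (`ZpCorank.finite_torsion`); no hypothesis on `W` or `p`.
[cite: Kato2004Asterisque, Thm. 14.5 (1) (p. 236) and §8.2 / Lemma 8.5 (pp. 180–184)] -/
theorem MemberHullInputs.finite_torsion_A (D : MemberHullInputs W p κ γ I y) :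
    Finite (AddCommGroup.torsion D.A) := by
  haveI := module_finite_integralH1_layerZero W p κ
  haveI := ZpCorank.finite_torsion p (integralH1 (tateRep W p) p (κ.layerSubgroup 0))
  have hmem : ∀ a : D.A, D.toH1 a ∈ integralH1 (tateRep W p) p (κ.layerSubgroup 0) := fun a =>
    (D.mem_range_toH1_iff _).mp ⟨a, rfl⟩
  refine Finite.of_injective (fun a : AddCommGroup.torsion D.A =>
    (⟨⟨D.toH1 (a : D.A), hmem a⟩, ?_⟩ : Submodule.torsion ℤ_[p] (integralH1 (tateRep W p) p (κ.layerSubgroup 0))))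
    ?_
  · obtain ⟨n, hn, hna⟩ := (isOfFinAddOrder_iff_nsmul_eq_zero).mp ((AddCommGroup.mem_torsion (a : D.A)).mp a.2)
    rw [Submodule.mem_torsion_iff]
    refine ⟨⟨(n : ℤ_[p]), mem_nonZeroDivisors_of_ne_zero (Nat.cast_ne_zero.mpr hn.ne')⟩, Subtype.ext ?_⟩
    change (n : ℤ_[p]) • D.toH1 (a : D.A) = 0
    rw [Nat.cast_smul_eq_nsmul, ← map_nsmul, hna, map_zero]
  · intro a b h
    have h' : D.toH1 (a : D.A) = D.toH1 (b : D.A) :=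
      congrArg (fun z : Submodule.torsion ℤ_[p] (integralH1 (tateRep W p) p (κ.layerSubgroup 0)) =>
        ((z : integralH1 (tateRep W p) p (κ.layerSubgroup 0)) : H1 (tateRep W p) (κ.layerSubgroup 0))) h
    exact Subtype.ext (D.toH1_injective h')

end Member

end Summit.BirchSwinnertonDyer.BirchSwinnertonDyer.Theorems.IntegralH1RankZero

end
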